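import Summits.QuantumFields.BalabanUV.Beta.FP.ConstrainedBiLaplacianResponseFull
import Summits.QuantumFields.BalabanUV.Beta.FP.BiLaplaceBlockResponse

/-!
# `BalabanUV.Beta.FP.ConstrainedBiLaplacianResponseJunction` — road «FP» for binder row D1, DESIGN ROW **GHOST-STEP** brick (g3) «(CONV-C)-Hb»,
# FILE 4b — THE JUNCTION: d1-p3's block-sum response kernel `BiLaplaceBlockResponse.Hb` (brick (g1), p280915; `= −Wbᵀ` by its (g1″) p282108) IS the
# real part of the lattice kernel of the lineage's fibre multiplier `hM N 2` (FILE 3), by an2's canonicity `eq_Hb_of_solvesB`; hence `Hb` (equivalently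
# an2's multiplier kernel `Wb`) inherits FILE 3's LEVEL-FREE exponential majorant in block-mean normalisation:
# `|N^{d+1}·Hb_N(x, y₀)| ≤ C(d)·e^{−kappaB·|⌊x∕N⌋ − y₀|_∞}` for EVERY `N ≥ 1`

NOT IN PRINT; OUR PROOF ATTEMPT (binder row G-an2-4 ∕ (CONV-C), prover part P3 = fibre∕strip «Woodbury» lineage, gen 28; CRUX TEAM (2),
2026-08-21).  HONEST DEPENDENCY (cell records, verbatim): «continuum YM on T⁴ ⇐ BetaPertH ∧ nine spine estimates (0/9 proved); BetaPertH ⇐ (D1) ∧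
(D4) ∧ CAP+tail; G-an2-4 gates asym, D1 and NE2/3/4.»  HONEST FRAMING (cell contract, verbatim): «discharging `BetaPertH` makes Bałaban's UV
stability UNCONDITIONAL — a real constructive-QFT result; it is NOT the continuum limit and NOT the Clay problem.»  ABSOLUTE RULE (cell charter,
verbatim): «No internally-minted statement may enter as a cited fact. Every hypothesis is either kernel-proved in this package or a verbatim quotation
of a PUBLISHED theorem with page reference. The manuscript(s) under audit are NOT citable for their own disputed steps — they are the thing under
adjudication; programme-internal (2001/route/tribunal) claims are never citable.»  THIS MODULE is [folklore] bookkeeping over FILE 4a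
(`ConstrainedBiLaplacianResponseFull`), FILE 3 (`response_decay`) and d1-p3's `FP/BiLaplaceBlockResponse` (`Hb`, `HWb`, `eq_Hb_of_solvesB`) with an2's
`BiLaplaceBlockGreen.SolvesB` ∕ `KKTFluctuationUnique.Tempered0` ∕ `KernelSpecInstance.re0` BY NAME; it cites nothing as a hypothesis, has TWO bookkeeping
`def`s (`lamH`, `omegaFun`), no `def … : Prop`, no `sorry`.

## Contents (dimension `d+1`; blocks of side `N ≥ 1`; order `s = 2`)

* §1 the kernel identities: **`negLap_negLap_KH`** (`(−Δ)²_z KH N 2 z y₀ = N^{−(d+1)}·omegaKer N (⌊z∕N⌋ − y₀)` — two passages multiplier ↦ kernel by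
  `B4Green244.opD_latticeKernel`, FILE 4a's `negLap_negLap_Hfull` on the zone, `latticeKernel_phase_mul`), **`sum_finePt_KH`** (`Σ_j KH N s (N•y+j) y₀ = [y = y₀]`).
* §2 an2's system: `lamH N y₀ := Re KH N 2 · y₀`, `omegaFun N y₀ := Re (N^{−(d+5)}·omegaKer N (· − y₀))`; **`lamH_EL`**
  (`codiff₁(dz(codiff₁(dz lamH))) x = omegaFun (quo N x)`), **`lamH_M`** (`blockSum N lamH y = [y = y₀]`), **`solvesB_lamH`**, `tempered_lamH`, `tempered_omegaFun`.
* §3 **`Hb_eq_re_KH : BiLaplaceBlockResponse.Hb (N := N) x y₀ = (KH N 2 x y₀).re`**, `HWb_eq_omegaFun`, **`abs_Hb_le`**, **`abs_Hb_scaled_le`**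
  (`|(N^{d+1})·Hb_N(x, y₀)| ≤ 2^{d+1}·CG (d+1) 2·(64∕7)²·(48 ζ_{d+1})^{d+1}·e^{−kappaB (d+1) 2·|⌊x∕N⌋ − y₀|_∞}`, every `N ≥ 1`) and **`Hb_tower_uniform`**
  (`∃ κ > 0, C ≥ 0` free of `N`) — THE UNIFORM HALF OF «(CONV-C)-Hb» FOR d1-p3's KERNEL BY NAME.

NOT HERE (honest): the convergence ∕ one-step RATE half; the same junction for the compressed inverse `Sb` and its multiplier `Wb` (FILES 5a∕5b).  0∕4 row-D1
binders touched.  NOT (CONV-C), NEVER «G-an2-4 closed», NOT the ghost step law, NOT SDF, NOT D1, NOT BetaPertH, NOT continuum, NOT Clay.  Provenance: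
prover-b2b-balaban-gan24-p3-g28-0 (unit `b2b-balaban-gan24-p3`, gen 28), 2026-08-21; no existing file touched.
-/

noncomputable section

namespace Summit.QuantumFields.BalabanUV.Beta.FP.ConstrainedBiLaplacianResponseJunction

open Complex Finset ComplexConjugate MeasureTheory
open Literature.MathematicalPhysics.QuantumFieldTheory
open Literature.MathematicalPhysics.QuantumFieldTheory.Balaban1983to89
open Literature.MathematicalPhysics.QuantumFieldTheory.Balaban1983to89.B4Strip
open Literature.MathematicalPhysics.QuantumFieldTheory.Balaban1983to89.B4StripCauchy
open Literature.MathematicalPhysics.QuantumFieldTheory.Balaban1983to89.B5Strip145Analytic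
open Literature.MathematicalPhysics.QuantumFieldTheory.Balaban1983to89.B5Strip145Decay
open Literature.MathematicalPhysics.QuantumFieldTheory.Balaban1983to89.B4StripSums
open Literature.MathematicalPhysics.QuantumFieldTheory.Balaban1983to89.B4StripSumsHolder (PhZ efZ differentiableAt_PhZ)
open Literature.MathematicalPhysics.QuantumFieldTheory.Balaban1983to89.B4ContourShift
open Literature.MathematicalPhysics.QuantumFieldTheory.Balaban1983to89.B4Green244 (e coarse offset finePt finePt_coarse_offset coarse_finePt
  phaseC V F_zero PhZ_finePt lap_PhZ sum_PhZ_V negLap blockAvg opD opD_latticeKernel latticeKernel_phase_mul latticeKernel_congr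
  latticeKernel_sum_mul latticeKernel_one latticeKernel_phase integrableOn_of_differentiableAt)
open Summit.QuantumFields.BalabanUV.Beta.FP.ConstrainedBiLaplacianStrip
open Summit.QuantumFields.BalabanUV.Beta.FP.ConstrainedBiLaplacianFibre
open Summit.QuantumFields.BalabanUV.Beta.FP.ConstrainedBiLaplacianFibreEntries
open Summit.QuantumFields.BalabanUV.Beta.FP.ConstrainedBiLaplacianFibreSides
open Summit.QuantumFields.BalabanUV.Beta.FP.ConstrainedBiLaplacianKernel
open Summit.QuantumFields.BalabanUV.Beta.FP.ConstrainedBiLaplacianFibreIdentities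
open Summit.QuantumFields.BalabanUV.Beta.FP.ConstrainedBiLaplacianResponse
open Summit.QuantumFields.BalabanUV.Beta.FP.ConstrainedBiLaplacianResponseFull
open Literature.MathematicalPhysics.QuantumFieldTheory.Balaban1983to89.B4Green242Bridge (latticeKernel_const_mul)
open Literature.MathematicalPhysics.QuantumFieldTheory.Balaban1983to89.Beta.AffineAveraging (Site Form0 dz codiff₁ unitVec box toSite blockSum)
open Literature.MathematicalPhysics.QuantumFieldTheory.LatticeForm (quo)
open Literature.MathematicalPhysics.QuantumFieldTheory.Balaban1983to89.Beta.KKTFluctuationUnique (Tempered0)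
open Literature.MathematicalPhysics.QuantumFieldTheory.Balaban1983to89.Beta.KernelSpecInstance (re0 re0_apply re1_dz re0_codiff₁)
open Literature.MathematicalPhysics.QuantumFieldTheory.Balaban1983to89.Beta.BiLaplaceBlockGreen (SolvesB)
open Summit.QuantumFields.BalabanUV.Beta.FP.BiLaplaceBlockResponse (Hb HWb eq_Hb_of_solvesB)
open scoped Real

variable {d : ℕ}

variable (N : ℕ) [NeZero N]

/-! ## §1 The kernel identities -/

/-- [folklore] **`(−Δ)²` OF THE KERNEL** (two passages multiplier ↦ kernel by `opD_latticeKernel`, then `negLap_negLap_Hfull` on the zone and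
`latticeKernel_phase_mul`): `negLap N (negLap N (KH N 2 · y₀)) x = N^{−(d+1)}·omegaKer N (coarse N x − y₀)`. -/
theorem negLap_negLap_KH (y₀ x : Fin (d + 1) → ℤ) :
    negLap N (negLap N (fun z => KH N 2 z y₀)) x = (((N : ℂ) ^ (d + 1))⁻¹) * omegaKer N (coarse N x - y₀) := by
  -- first passage
  have hK : (fun z => KH N 2 z y₀) = fun z => latticeKernel (Hfull N 2 z) (-y₀) := by
    funext z; exact KH_eq N 2 z y₀
  have hint1 : ∀ z', IntegrableOn (integrand (Hfull N 2 z') (-y₀)) (BZ (d + 1)) := fun z' =>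
    integrableOn_of_differentiableAt (fun p hp => differentiableAt_Hfull N 2 z' p hp) (-y₀)
  have step1 : negLap N (fun z => KH N 2 z y₀)
      = fun z => latticeKernel (fun P => ∑ k : Fin (d + 1) → Fin N,
          PhZ N k z P * (DeltaXi N 0 (shift N k P) * ((((N : ℂ) ^ (d + 1))⁻¹) * bvec N 2 P k))) (-y₀) := by
    funext z
    rw [hK, negLap_eq_opD, opD_latticeKernel N 0 0 (fun z' P => Hfull N 2 z' P) (-y₀) hint1 z]
    congr 1
    funext P
    rw [← negLap_eq_opD]
    exact negLap_Hfull N 2 z P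
  -- second passage
  set c : (Fin (d + 1) → Fin N) → (Fin (d + 1) → ℂ) → ℂ :=
    fun k P => DeltaXi N 0 (shift N k P) * ((((N : ℂ) ^ (d + 1))⁻¹) * bvec N 2 P k) with hc
  have hcd : ∀ k, ∀ P ∈ Strip (d + 1) (kappaB (d + 1) 2), DifferentiableAt ℂ (c k) P := fun k P hP =>
    (differentiableAt_DeltaXi_shift N 0 k P).mul ((differentiableAt_bvec N 2 k hP).const_mul _)
  have hint2 : ∀ z', IntegrableOn (integrand (fun P => ∑ k : Fin (d + 1) → Fin N, PhZ N k z' P * c k P) (-y₀)) (BZ (d + 1)) :=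
    fun z' => integrableOn_of_differentiableAt (fun p hp => differentiableAt_sum_PhZ N 2 c hcd z' p hp) (-y₀)
  rw [step1, negLap_eq_opD, opD_latticeKernel N 0 0 (fun z' P => ∑ k : Fin (d + 1) → Fin N, PhZ N k z' P * c k P) (-y₀) hint2 x]
  -- the symbol identity on the zone, then the phase translates the kernel
  have hzone : ∀ p ∈ BZ (d + 1), opD N 0 0 (fun z' => ∑ k : Fin (d + 1) → Fin N, PhZ N k z' (ofRealVec p) * c k (ofRealVec p)) x
      = (fun P => cexp (I * phaseC P (coarse N x)) * ((((N : ℂ) ^ (d + 1))⁻¹) * omegaSym N P)) (ofRealVec p) := by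
    intro p hp
    show _ = cexp (I * phaseC (ofRealVec p) (coarse N x)) * ((((N : ℂ) ^ (d + 1))⁻¹) * omegaSym N (ofRealVec p))
    have hP := ofRealVec_mem_strip 2 hp
    have h := negLap_negLap_Hfull N x hP
    have h1 : negLap N (fun z' => Hfull N 2 z' (ofRealVec p))
        = fun z' => ∑ k : Fin (d + 1) → Fin N, PhZ N k z' (ofRealVec p) * c k (ofRealVec p) := by
      funext z'; exact negLap_Hfull N 2 z' (ofRealVec p)
    rw [← negLap_eq_opD, ← h1, h]
    unfold omegaSym
    ring
  rw [latticeKernel_congr (G1 := fun P => opD N 0 0 (fun z' => ∑ k : Fin (d + 1) → Fin N, PhZ N k z' P * c k P) x)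
    (G2 := fun P => cexp (I * phaseC P (coarse N x)) * ((((N : ℂ) ^ (d + 1))⁻¹) * omegaSym N P)) hzone (-y₀),
    latticeKernel_phase_mul, neg_add_eq_sub, latticeKernel_const_mul]
  rfl

/-- [folklore] **THE BLOCK SUMS OF THE KERNEL**: `Σ_j KH N s (N•y + j) y₀ = [y = y₀]` (`sum_finePt_Hfull` on the zone, `latticeKernel_phase`). -/
theorem sum_finePt_KH (s : ℕ) (y y₀ : Fin (d + 1) → ℤ) :
    ∑ j : Fin (d + 1) → Fin N, KH N s (finePt N y j) y₀ = if y = y₀ then 1 else 0 := by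
  have hint : ∀ j ∈ (Finset.univ : Finset (Fin (d + 1) → Fin N)),
      IntegrableOn (integrand (Hfull N s (finePt N y j)) (-y₀)) (BZ (d + 1)) := fun j _ =>
    integrableOn_of_differentiableAt (fun p hp => differentiableAt_Hfull N s (finePt N y j) p hp) (-y₀)
  simp_rw [KH_eq]
  have h := latticeKernel_sum_mul Finset.univ (fun _ => (1 : ℂ)) (fun j => Hfull N s (finePt N y j)) (-y₀) hint
  simp only [one_mul] at h
  rw [← h, latticeKernel_congr (G1 := fun P => ∑ j : Fin (d + 1) → Fin N, Hfull N s (finePt N y j) P)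
    (G2 := fun P => cexp (I * phaseC P y)) (fun p hp => sum_finePt_Hfull N s y (ofRealVec_mem_strip s hp)) (-y₀),
    latticeKernel_phase]
  by_cases hy : y = y₀
  · rw [if_pos hy, if_pos (by rw [hy, neg_add_cancel])]
  · rw [if_neg hy, if_neg (fun h' => hy (neg_add_eq_zero.mp h').symm)]

/-! ## §2 The kernel solves an2's force-free block system -/

/-- [our object] The candidate kernel column in an2's (real) vocabulary: `lamH N y₀ x = Re KH N 2 x y₀`. -/
def lamH (y₀ : Fin (d + 1) → ℤ) : Form0 (d + 1) ℝ := fun x => (KH N 2 x y₀).re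

/-- [our object] The candidate coarse multiplier: `omegaFun N y₀ y = Re (N^{−(d+5)}·omegaKer N (y − y₀))`. -/
def omegaFun (y₀ : Fin (d + 1) → ℤ) : Form0 (d + 1) ℝ := fun y => ((((N : ℂ) ^ (d + 5))⁻¹) * omegaKer N (y - y₀)).re

/-- [folklore] **THE EULER–LAGRANGE ROW**: `codiff₁ (dz (codiff₁ (dz (lamH N y₀)))) x = omegaFun N y₀ (quo N x)` (force-free). -/
theorem lamH_EL (y₀ x : Fin (d + 1) → ℤ) :
    codiff₁ (dz (codiff₁ (dz (lamH (d := d) N y₀)))) x = omegaFun N y₀ (quo N x) := by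
  have hNC : (N : ℂ) ≠ 0 := Nat.cast_ne_zero.mpr (NeZero.ne N)
  have hre : lamH (d := d) N y₀ = re0 (fun x => KH N 2 x y₀) := rfl
  rw [hre, ← re1_dz, ← re0_codiff₁, ← re1_dz, ← re0_codiff₁, re0_apply]
  have h1 : codiff₁ (dz (fun x => KH N 2 x y₀)) = fun x => (((N : ℂ) ^ 2)⁻¹) * negLap N (fun x => KH N 2 x y₀) x := by
    funext x; exact codiff₁_dz_eq_negLap N _ x
  rw [h1, codiff₁_dz_eq_negLap N, negLap_const_mul, negLap_negLap_KH]
  unfold omegaFun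
  have hq : quo N x = coarse N x := rfl
  rw [hq]
  congr 1
  field_simp
  ring

/-- [folklore] **THE BLOCK-SUM ROW**: `blockSum N (lamH N y₀) y = [y = y₀]`. -/
theorem lamH_M (y₀ y : Fin (d + 1) → ℤ) : blockSum N (lamH (d := d) N y₀) y = if y = y₀ then (1 : ℝ) else 0 := by
  unfold blockSum lamH
  rw [blockSum_eq_sum_finePt N (fun x => (KH N 2 x y₀).re) y, ← Complex.re_sum, sum_finePt_KH]
  split_ifs <;> simp

/-- [folklore] The candidate pair solves an2's force-free block system with the unit block sum at `y₀`. -/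
theorem solvesB_lamH (y₀ : Fin (d + 1) → ℤ) :
    SolvesB N 0 (fun y => if y = y₀ then (1 : ℝ) else 0) (lamH (d := d) N y₀) (omegaFun N y₀) where
  el x := by rw [lamH_EL, Pi.zero_apply, add_zero]
  mean y := lamH_M N y₀ y

/-- [folklore] The kernel column is bounded (FILE 3's `response_decay`), hence tempered. -/
theorem tempered_lamH (y₀ : Fin (d + 1) → ℤ) : Tempered0 (lamH (d := d) N y₀) := by
  refine Tempered0.of_bounded (B := ((N : ℝ) ^ (d + 1))⁻¹ * (2 ^ (d + 1) * CG (d + 1) 2 * SW N (d + 1) 2)) fun x => ?_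
  unfold lamH KH
  have h := response_decay N 2 (offset N x) (coarse N x - y₀)
  have hexp : Real.exp (-(kappaB (d + 1) 2 * supNorm (coarse N x - y₀))) ≤ 1 := by
    rw [Real.exp_le_one_iff]
    have := kappaB_pos (d + 1) 2
    have := supNorm_nonneg (coarse N x - y₀)
    nlinarith
  have hC : 0 ≤ ((N : ℝ) ^ (d + 1))⁻¹ * (2 ^ (d + 1) * CG (d + 1) 2 * SW N (d + 1) 2) := by
    have := CG_nonneg (d + 1) 2; have := SW_nonneg N (d + 1) 2; positivity
  calc |(latticeKernel (hM N 2 (offset N x)) (coarse N x - y₀)).re|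
      ≤ ‖latticeKernel (hM N 2 (offset N x)) (coarse N x - y₀)‖ := Complex.abs_re_le_norm _
    _ ≤ ((N : ℝ) ^ (d + 1))⁻¹ * (2 ^ (d + 1) * CG (d + 1) 2 * SW N (d + 1) 2) * 1 := by
        exact h.trans (mul_le_mul_of_nonneg_left hexp hC)
    _ = _ := mul_one _

/-- [folklore] The multiplier kernel is bounded, hence the candidate multiplier is tempered. -/
theorem tempered_omegaFun (y₀ : Fin (d + 1) → ℤ) : Tempered0 (omegaFun (d := d) N y₀) := by
  set B : ℝ := (16 * ((d + 1 : ℕ) : ℝ)) ^ 2 * (cB (d + 1))⁻¹ with hB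
  have hcB := cB_pos (d + 1)
  have hBnn : 0 ≤ B := by positivity
  refine Tempered0.of_bounded (B := ((N : ℝ) ^ (d + 5))⁻¹ * B) fun y => ?_
  unfold omegaFun omegaKer
  have h := latticeKernel_decay (stripRegular_omegaSym (d := d) N) (kappaB_pos (d + 1) 2).le (y - y₀)
  have hexp : Real.exp (-(kappaB (d + 1) 2 * supNorm (y - y₀))) ≤ 1 := by
    rw [Real.exp_le_one_iff]
    have := kappaB_pos (d + 1) 2
    have := supNorm_nonneg (y - y₀)
    nlinarith
  calc |((((N : ℂ) ^ (d + 5))⁻¹) * latticeKernel (omegaSym N) (y - y₀)).re|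
      ≤ ‖(((N : ℂ) ^ (d + 5))⁻¹) * latticeKernel (omegaSym N) (y - y₀)‖ := Complex.abs_re_le_norm _
    _ = ((N : ℝ) ^ (d + 5))⁻¹ * ‖latticeKernel (omegaSym N) (y - y₀)‖ := by
        rw [norm_mul, norm_inv, norm_pow, Complex.norm_natCast]
    _ ≤ ((N : ℝ) ^ (d + 5))⁻¹ * (B * 1) := by
        refine mul_le_mul_of_nonneg_left ?_ (by positivity)
        exact h.trans (mul_le_mul_of_nonneg_left hexp hBnn)
    _ = _ := by rw [mul_one]

/-! ## §3 The junction with `BiLaplaceBlockResponse.Hb` and the level-free majorant -/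

/-- [our proof] **THE JUNCTION**: d1-p3's block-sum response kernel IS the real part of the lineage's fibre kernel —
`Hb (N := N) x y₀ = (KH N 2 x y₀).re` — and its coarse multiplier is `omegaFun` (an2's canonicity `eq_Hb_of_solvesB`). -/
theorem Hb_eq_re_KH (x y₀ : Fin (d + 1) → ℤ) : Hb (N := N) x y₀ = (KH N 2 x y₀).re := by
  have h := eq_Hb_of_solvesB (N := N) (solvesB_lamH (d := d) N y₀) (tempered_lamH N y₀) (tempered_omegaFun N y₀)
  have := congrFun h.1 x
  exact this.symm

/-- [our proof] The coarse multiplier of `Hb` in fibre form: `HWb (N := N) y y₀ = omegaFun N y₀ y`. -/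
theorem HWb_eq_omegaFun (y y₀ : Fin (d + 1) → ℤ) : HWb (N := N) y y₀ = omegaFun (d := d) N y₀ y := by
  have h := eq_Hb_of_solvesB (N := N) (solvesB_lamH (d := d) N y₀) (tempered_lamH N y₀) (tempered_omegaFun N y₀)
  exact (congrFun h.2 y).symm

/-- [our proof] **EXPONENTIAL DECAY OF `Hb` ON THE BLOCK SCALE** (FILE 3's `response_decay` through the junction):
`|Hb_N(x, y₀)| ≤ ((N:ℝ)^{d+1})⁻¹·2^{d+1}·CG (d+1) 2·SW N (d+1) 2·e^{−kappaB (d+1) 2·|⌊x∕N⌋ − y₀|_∞}`. -/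
theorem abs_Hb_le (x y₀ : Fin (d + 1) → ℤ) :
    |Hb (N := N) x y₀| ≤ ((N : ℝ) ^ (d + 1))⁻¹ * (2 ^ (d + 1) * CG (d + 1) 2 * SW N (d + 1) 2) *
      Real.exp (-(kappaB (d + 1) 2 * supNorm (coarse N x - y₀))) := by
  rw [Hb_eq_re_KH]
  exact (Complex.abs_re_le_norm _).trans (response_decay N 2 (offset N x) (coarse N x - y₀))

/-- [our proof] **THE LEVEL-FREE MAJORANT OF `Hb` IN BLOCK-MEAN NORMALISATION**: for EVERY `N ≥ 1` and all `x, y₀`,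
`|(N^{d+1})·Hb_N(x, y₀)| ≤ 2^{d+1}·CG (d+1) 2·(64∕7)²·(48 ζ_{d+1})^{d+1}·e^{−kappaB (d+1) 2·|⌊x∕N⌋ − y₀|_∞}` — rate AND prefactor free of `N`. -/
theorem abs_Hb_scaled_le (x y₀ : Fin (d + 1) → ℤ) :
    |(N : ℝ) ^ (d + 1) * Hb (N := N) x y₀| ≤ 2 ^ (d + 1) * CG (d + 1) 2 * ((64 / 7) ^ 2 * (48 * zetaC (d + 1)) ^ (d + 1)) *
      Real.exp (-(kappaB (d + 1) 2 * supNorm (coarse N x - y₀))) := by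
  have h := response_decay_scaled N (s := 2) (by norm_num) (offset N x) (coarse N x - y₀)
  rw [Hb_eq_re_KH]
  unfold KH
  have e : (N : ℝ) ^ (d + 1) * (latticeKernel (hM N 2 (offset N x)) (coarse N x - y₀)).re
      = (((N : ℂ) ^ (d + 1)) * latticeKernel (hM N 2 (offset N x)) (coarse N x - y₀)).re := by
    rw [show ((N : ℂ) ^ (d + 1)) = (((N : ℝ) ^ (d + 1) : ℝ) : ℂ) by push_cast; rfl, Complex.re_ofReal_mul]
  rw [e]
  exact (Complex.abs_re_le_norm _).trans h

/-- [our proof] **«(CONV-C)-Hb», THE UNIFORM HALF, FOR d1-p3's KERNEL BY NAME**: ONE rate `κ > 0` and ONE constant `C ≥ 0`, free of `N`, with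
`|(N^{d+1})·Hb_N(x, y₀)| ≤ C·e^{−κ·|⌊x∕N⌋ − y₀|_∞}` for ALL `N ≥ 1`, `x`, `y₀`. -/
theorem Hb_tower_uniform (d : ℕ) :
    ∃ κ C : ℝ, 0 < κ ∧ 0 ≤ C ∧ ∀ (N : ℕ) [NeZero N] (x y₀ : Fin (d + 1) → ℤ),
      |(N : ℝ) ^ (d + 1) * Hb (N := N) x y₀| ≤ C * Real.exp (-(κ * supNorm (coarse N x - y₀))) := by
  refine ⟨kappaB (d + 1) 2, 2 ^ (d + 1) * CG (d + 1) 2 * ((64 / 7) ^ 2 * (48 * zetaC (d + 1)) ^ (d + 1)), kappaB_pos (d + 1) 2, ?_,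
    fun N _ x y₀ => abs_Hb_scaled_le N x y₀⟩
  have := CG_nonneg (d + 1) 2
  have := zetaC_nonneg (d + 1)
  positivity

end Summit.QuantumFields.BalabanUV.Beta.FP.ConstrainedBiLaplacianResponseJunction

end
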